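import Mathlib
import HarnessLib
import Summits.HubbardSuperconductivity.HubbardSuperconductivity.Theorems.ComplexGFFStiffnessHypACumulantTunedRepresentation
import Literature.Dynamics.Hyperbolic.RGFlowStableManifoldReducedLipschitz
import Summits.HubbardSuperconductivity.HubbardSuperconductivity.Theorems.ComplexGFFStiffnessHypALocalTwoPointTunedSystemIntegral
import Summits.HubbardSuperconductivity.HubbardSuperconductivity.Theorems.ComplexGFFStiffnessHypALocalTwoPointFreeEnergyPieces

/-!
# Crux `HypALocalTwoPoint`, line `gnv` — the SECOND-DIFFERENCE CLAUSE of `FreeEnergyBounds` at fixed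
# `(L, N)` from the six sizes (census F1 (iii-c): the assembly proper)

Route `route-HubbardSuperconductivity-ComplexGFFStiffness`, crux item stmt-HubbardSuperconductivity-19155,
registered stub `stub_twoPointGivenZ` (⇐ `FreeEnergyBounds`, p817758).  Composition of the landed layers
of the census entry F1 of FREEENERGY-PLAN-cgffstiff2-g1 §3: `…FreeEnergyRepresentation`
(`pertZ = Z₀ · exp f`, `f = log κ + |Λ|λ + Log I`), `…FreeEnergyPieces` (differences of `f` from those
of seeds and integrals), `…TunedSystemIntegral` (`I = 1 + Φ(x₀, y_N)`, `‖I − 1‖ ≤ εη^N A⁻¹A_𝒫`) and — as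
INPUT sizes — the six numbers produced by `…FreeEnergySizes.freeEnergySizes_of_package`:

* **`norm_secondDiff_freeEnergy_le_of_sizes`** — under the [ABKM19] package at fixed `(L, N)`, for four
  tuned seeds of the systems `𝒦 + iU + jV` whose seed differences are `≤ T₁, T₂, T₁₂` and whose
  last-scale functionals differ by `≤ B₁, B₂, B₁₂`: the mixed second difference of the free energy is
  `≤ |Λ|c_qT₁₂ + 2|Λ|c_q²T₁T₂ + |Λ|T₁₂ + B₁₂/(1−R₀) + B₁B₂/(1−R₀)²`.

With `freeEnergySizes_of_package` (F4/F5 as hypotheses) this is the second-difference clause of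
`FreeEnergyBounds` at fixed `(L, N)` modulo the packaging of constants.  No `sorry`, no new named fact.

## References
* S. Adams, S. Buchholz, R. Kotecký, S. Müller, arXiv:1910.13564, Theorem 2.2, Ch. 4 (4.7)–(4.12),
  Ch. 12, Lemma 12.6 [AdamsBuchholzKoteckyMuller2019].
-/




noncomputable section

-- `Summit.<Summit>.<Problem>`: single-conjunct summit, the duplicate component is mandated (D-0017).
set_option linter.dupNamespace false

namespace Summit.HubbardSuperconductivity.HubbardSuperconductivity.Theorems.ComplexGFF

open scoped BigOperators ComplexConjugate
open Real Set Finset MeasureTheory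
open Literature.MathematicalPhysics.StatisticalMechanics.GradientRG
open Literature.MathematicalPhysics.StatisticalMechanics.GradientFRD
  (fourierCoeff cExt cExt_of_mem IsElliptic IsUnitSymm InShell iterDiff supNorm conv ellOp isElliptic_one)
open Literature.MathematicalPhysics.StatisticalMechanics.TorusPolymer
  (IsPolymer numBlocks blockOf boxCorner isPolymer_blockOf isConn_blockOf pcirc)
open Literature.Barriers.CriticalPhenomena.LongRangePhi4.Polymer (IsConn components)
open Literature.MathematicalPhysics.QuantumFieldTheory
open Literature.Dynamics.Hyperbolic

variable {d M : ℕ} [NeZero M]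

section Package

variable {L N Mord R n ñ : ℕ} {θbar lam μ δ₁ δ₀ A𝒫 : ℝ}
    {𝒞 : Matrix (Fin d) (Fin d) ℝ → ℕ → (Fin d → ZMod M) → ℝ} {Mc : ℕ → ℝ}
    {Cα : (Fin d → ℕ) → ℕ → ℝ} {c C : ℝ} {Cℓ : ℕ → ℝ}

set_option maxHeartbeats 3200000 in
/-- **Mixed second differences of the free energy at fixed `(L, N)` from the six sizes** ([ABKM19]
Theorem 2.2, `ℓ = 2`, difference form, `ι`-symmetric complex class; census F1 (iii-c)): under the
[ABKM19] package at fixed `(L, N)`, for four tuned seeds `x₀ i j` of the systems of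
`Kf i j ∈ {𝒦, 𝒦+U, 𝒦+V, 𝒦+U+V}` with seed sizes `T₁, T₂, T₁₂` and last-scale-functional sizes
`B₁, B₂, B₁₂` (the outputs of `freeEnergySizes_of_package`), the free energies
`f_{ij} = log κ_{𝟙,𝟙+q(x₀ i j)} + |Λ|·λ(x₀ i j) + Log I_{ij}` (`pertZ = Z₀ · exp f`, `…FreeEnergyRepresentation`)
satisfy `‖f₁₁ − f₁₀ − f₀₁ + f₀₀‖ ≤ |Λ|c_qT₁₂ + 2|Λ|c_q²T₁T₂ + |Λ|T₁₂ + B₁₂/(1−R₀) + B₁B₂/(1−R₀)²`,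
`c_q = 2d²/𝔥₀²`, `R₀ = 3εη^N A⁻¹A_𝒫` (`…FreeEnergyPieces` ∘ `…TunedSystemIntegral`). -/
theorem norm_secondDiff_freeEnergy_le_of_sizes {h : ℝ} [Fact (0 < h)] [Fact (0 < L)]
    (hd : 3 ≤ d) (hMord : 1 ≤ Mord) (hMR : Mord ≤ R) (hLodd : Odd L) (hL : 2 ^ (d + 3) + 16 * R ≤ L)
    (hR2 : 2 ≤ R) (hM : M = L ^ N)
    (hθbar : 0 < θbar) (hlam : 0 < lam) (hn : 2 * Mord ≤ n) (hn2 : 2 ≤ n) (hnñ : n ≤ ñ)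
    (hc : 0 < c) (hC1 : 0 ≤ Cℓ 1)
    (hallA : ∀ A : Matrix (Fin d) (Fin d) ℝ, IsElliptic (1 / 2 : ℝ) 2 A →
        (∀ k, 1 ≤ k → k ≤ N + 1 →
          ∑ x : Fin d → ZMod M, 𝒞 A k x = 0 ∧ ∀ x, 𝒞 A k (-x) = 𝒞 A k x) ∧
        (∀ k, 1 ≤ k → k ≤ N + 1 → ∀ φ : (Fin d → ZMod M) → ℝ, ∑ x, φ x = 0 →
          0 ≤ ∑ x, ∑ y, φ x * 𝒞 A k (x - y) * φ y) ∧
        (∀ φ : (Fin d → ZMod M) → ℝ, ∑ x, φ x = 0 →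
          ellOp A (conv (fun x => ∑ k ∈ Finset.Icc 1 (N + 1), 𝒞 A k x) φ) = φ) ∧
        (∀ k, 1 ≤ k → k ≤ N → Mc k ≤ 0 ∧
          ∀ x : Fin d → ZMod M, ((L : ℝ) ^ k) / 2 ≤ (supNorm x : ℝ) →
            𝒞 A k x = Mc k) ∧
        (∀ k, 1 ≤ k → k ≤ N + 1 → ∀ B : Matrix (Fin d) (Fin d) ℝ, IsUnitSymm B →
          (∃ ε : ℝ, 0 < ε ∧ ∀ x : Fin d → ZMod M,
            ContDiffOn ℝ ⊤ (fun s : ℝ => 𝒞 (A + s • B) k x) (Set.Ioo (-ε) ε)) ∧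
          ∀ α : Fin d → ℕ, ∑ i, α i ≤ n → ∀ ℓ : ℕ, ∀ x : Fin d → ZMod M,
            abs (iteratedDeriv ℓ (fun s : ℝ => iterDiff α (𝒞 (A + s • B) k) x) 0)
              ≤ Cα α ℓ / (L : ℝ) ^ ((k - 1) * (d - 2 + ∑ i, α i))) ∧
        (∀ k, 1 ≤ k → k ≤ N + 1 → ∀ j : ℕ, ∀ κ : Fin d → ZMod M, κ ≠ 0 → InShell L j κ →
          (j < k →
            c / (L : ℝ) ^ (2 * (d + ñ) + 1) * (L : ℝ) ^ (2 * j)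
                / (L : ℝ) ^ ((k - j) * (d - 1 + n)) ≤ (fourierCoeff (𝒞 A k) κ).re ∧
            ‖fourierCoeff (𝒞 A k) κ‖
              ≤ C * (L : ℝ) ^ (2 * (d + ñ) + 1) * (L : ℝ) ^ (2 * j)
                  / (L : ℝ) ^ ((k - j) * (d - 1 + n))) ∧
          (k ≤ j →
            c / (L : ℝ) ^ (2 * (d + ñ) + 1) * (L : ℝ) ^ (2 * k)
                ≤ (fourierCoeff (𝒞 A k) κ).re ∧
            ‖fourierCoeff (𝒞 A k) κ‖ ≤ C * (L : ℝ) ^ (2 * k)) ∧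
          ∀ B : Matrix (Fin d) (Fin d) ℝ, IsUnitSymm B → ∀ ℓ : ℕ, 1 ≤ ℓ →
            (j < k →
              ‖iteratedDeriv ℓ (fun s : ℝ => fourierCoeff (𝒞 (A + s • B) k) κ) 0‖
                ≤ Cℓ ℓ * (L : ℝ) ^ (2 * (d + ñ) + 1) * (L : ℝ) ^ (2 * j)
                    / (L : ℝ) ^ ((k - j) * (d - 1 + ñ))) ∧
            (k ≤ j →
              ‖iteratedDeriv ℓ (fun s : ℝ => fourierCoeff (𝒞 (A + s • B) k) κ) 0‖
                ≤ Cℓ ℓ * (L : ℝ) ^ (2 * k))))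
    (hB : AbkmWeightBounds L N Mord R n θbar lam μ δ₁ δ₀ A𝒫 (fun j => 𝒞 1 j)
      (abkmWeightData L N Mord R θbar (schedDelta δ₀ δ₁ N) fun j => 𝒞 1 j))
    {pT r₀ : ℕ} (hp : d / 2 + 2 ≤ pT) (hpM : pT + d ≤ Mord) (hr₀ : 3 ≤ r₀)
    (hδ₀ : 0 < δ₀) (hδ₁ : 0 < δ₁) (hh0 : hZeroSq d R δ₀ δ₁ ≤ h ^ 2)
    (hh2 : secondDiffConst (fun θ' => Cα θ' 0) ≤ h ^ 2)
    -- the tuning ball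
    {θ : ℝ} (hθ0 : 0 ≤ θ) (hθ : θ < θbar)
    {T₀ : ℝ} (hT₀ : T₀ ≤ 1 / 2) (hKT₀ : shellRatioConst c (Cℓ 1) (L : ℝ) d ñ * T₀ ≤ Real.log (1 + θ))
    {A𝒫' : ℝ} (hA𝒫' : weightIntConstRho θbar θ (traceConst d Mord R lam (derivSum d n fun θ' _ => Cα θ' 0)) = A𝒫')
    -- the side conditions of Theorem 6.8 (`RGStepABKMQ`), at `A_𝒫' = A_𝒫(θ)`
    {A : ℝ} (hA1 : 1 ≤ A) (hA𝒫A : A𝒫' ≤ A)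
    (hsmall : (2 : ℝ) ^ (L ^ d) * (A𝒫' * A ^ (-(1 - (1 + 1 / ((2 * (2 ^ d + 1) + 6 : ℝ) ^ d))⁻¹) : ℝ)) ≤ 1)
    {r : ℝ} (hr : r ≤ 1 / 64)
    (hv : vABKM d R A A𝒫' r ≤ 1 / 64) (hωA : omegaABKM d R A A𝒫' r * A ^ 2 ≤ 1)
    (hc3A : (kappaABKM d R A A𝒫' r) ^ (L ^ d) * ((2 * (2 * (kappaABKM d R A A𝒫' r) * max 1 A𝒫')) ^ ((2 ^ (d + 1) + 2) ^ d * L ^ d) * (4 : ℝ) ^ ((2 ^ (d + 1) + 2) ^ d * L ^ d)) ≤ A ^ ((1 + 1 / ((2 * (2 ^ d + 1) + 6 : ℝ) ^ d)) - 1 : ℝ))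
    (hc2A : (kappaABKM d R A A𝒫' r) ^ (L ^ d) * ((2 * (kappaABKM d R A A𝒫' r) * max 1 A𝒫') ^ ((2 ^ (d + 1) + 2) ^ d * L ^ d) * (2 : ℝ) ^ ((2 ^ (d + 1) + 2) ^ d * L ^ d)) ≤ A ^ ((1 + 1 / ((2 * (2 ^ d + 1) + 6 : ℝ) ^ d)) - 1 : ℝ))
    {η ε ρ : ℝ} (hη : 0 < η) (hη1 : η ≤ 1) (hε : 0 ≤ ε) (hεr : ε ≤ r) (hερ : ε ≤ ρ) (hρ16 : ρ ≤ 1 / 16)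
    (hp4 : 4 * pT ≤ 2 ^ (d + 2))
    (hqT₀ : 2 * (d : ℝ) ^ 2 / (((L ^ (d * 0) : ℕ) : ℝ) * (fieldWt h (L : ℝ) d 0 / (L : ℝ) ^ 0) ^ 2) * ρ ≤ T₀)
    (hqε : 2 * (d : ℝ) ^ 2 / (((L ^ (d * 0) : ℕ) : ℝ) * (fieldWt h (L : ℝ) d 0 / (L : ℝ) ^ 0) ^ 2) * ε ≤ 1 / 6)
    -- the four perturbations
    {𝒦 U V : (Fin d → ℝ) → ℂ} {ρ𝒦 : ℝ} (h𝒦 : ContDiff ℝ r₀ 𝒦) (hU : ContDiff ℝ r₀ U) (hV : ContDiff ℝ r₀ V)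
    (h𝒦b : ∀ s, s ≤ r₀ → ∀ z : Fin d → ℝ, ‖iteratedFDeriv ℝ s 𝒦 z‖ ≤ ρ𝒦 * Real.exp ((∑ i, z i ^ 2) / 4))
    (h𝒦Ub : ∀ s, s ≤ r₀ → ∀ z : Fin d → ℝ,
      ‖iteratedFDeriv ℝ s (fun z => 𝒦 z + U z) z‖ ≤ ρ𝒦 * Real.exp ((∑ i, z i ^ 2) / 4))
    (h𝒦Vb : ∀ s, s ≤ r₀ → ∀ z : Fin d → ℝ,
      ‖iteratedFDeriv ℝ s (fun z => 𝒦 z + V z) z‖ ≤ ρ𝒦 * Real.exp ((∑ i, z i ^ 2) / 4))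
    (h𝒦UVb : ∀ s, s ≤ r₀ → ∀ z : Fin d → ℝ,
      ‖iteratedFDeriv ℝ s (fun z => 𝒦 z + U z + V z) z‖ ≤ ρ𝒦 * Real.exp ((∑ i, z i ^ 2) / 4))
    (h𝒦small : (Real.exp (1 / 4) + 2 * Real.exp (3 / 8)) * (ρ𝒦 * Real.exp (fieldWt h (L : ℝ) d 0 / (L : ℝ) ^ 0)) * A ≤ 1 / 2)
    (Kf : Bool → Bool → (Fin d → ℝ) → ℂ) (hKtt : Kf true true = fun w => 𝒦 w + U w + V w)
    (hKtf : Kf true false = fun w => 𝒦 w + U w) (hKft : Kf false true = fun w => 𝒦 w + V w)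
    (hKff : Kf false false = 𝒦)
    -- the `h`-indexed system (abbreviations fixed by their defining equations)
    (Asys : (fun k => HamSpace ℂ d (fieldWt h (L : ℝ) d k) ((L : ℝ) ^ k) (L ^ (d * k))) 0 → (k : ℕ) → ((fun k => HamSpace ℂ d (fieldWt h (L : ℝ) d k) ((L : ℝ) ^ k) (L ^ (d * k))) k ≃L[ℝ] (fun k => HamSpace ℂ d (fieldWt h (L : ℝ) d k) ((L : ℝ) ^ k) (L ^ (d * k))) (k + 1)))
    (hAsys : Asys = fun h₀ => rgA L h (fun jj => 𝒞 ((1 : Matrix (Fin d) (Fin d) ℝ) + hamTuningMap ρ h₀) jj))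
    (Bsys : (fun k => HamSpace ℂ d (fieldWt h (L : ℝ) d k) ((L : ℝ) ^ k) (L ^ (d * k))) 0 → (k : ℕ) → ((fun k => activitySpace (abkmNormParams L N Mord R pT r₀ h θbar A (schedDelta δ₀ δ₁ N) fun j => 𝒞 1 j) k) k →+ (fun k => HamSpace ℂ d (fieldWt h (L : ℝ) d k) ((L : ℝ) ^ k) (L ^ (d * k))) (k + 1)))
    (hBsys : Eq Bsys fun h₀ =>
      rgBT hd hMord hMR hLodd hL hM hθbar hlam hn hn2 hnñ hc hC1 hallA hB pT r₀ hr₀ A hθ0 hθ hT₀ hKT₀ (hamTuningMap ρ h₀))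
    (Ssys : (fun k => HamSpace ℂ d (fieldWt h (L : ℝ) d k) ((L : ℝ) ^ k) (L ^ (d * k))) 0 → (k : ℕ) → (fun k => HamSpace ℂ d (fieldWt h (L : ℝ) d k) ((L : ℝ) ^ k) (L ^ (d * k))) k → (fun k => activitySpace (abkmNormParams L N Mord R pT r₀ h θbar A (schedDelta δ₀ δ₁ N) fun j => 𝒞 1 j) k) k → (fun k => activitySpace (abkmNormParams L N Mord R pT r₀ h θbar A (schedDelta δ₀ δ₁ N) fun j => 𝒞 1 j) k) (k + 1))
    (hSsys : Ssys = fun h₀ =>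
      rgSQ (L := L) (N := N) (Mord := Mord) (R := R) (p := pT) (r₀ := r₀) (h := h) (θbar := θbar) (A := A)
            (δ₀ := δ₀) (δ₁ := δ₁) (𝒞 := fun j => 𝒞 1 j) (fun jj => 𝒞 ((1 : Matrix (Fin d) (Fin d) ℝ) + hamTuningMap ρ h₀) jj))
    (Φ : (fun k => HamSpace ℂ d (fieldWt h (L : ℝ) d k) ((L : ℝ) ^ k) (L ^ (d * k))) 0 → (fun k => activitySpace (abkmNormParams L N Mord R pT r₀ h θbar A (schedDelta δ₀ δ₁ N) fun j => 𝒞 1 j) k) N → ℂ)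
    (hΦ : Φ = fun h₀ yN =>
      (∫ φ, ((yN : activitySpace (abkmNormParams L N Mord R pT r₀ h θbar A (schedDelta δ₀ δ₁ N) fun j => 𝒞 1 j) N) : Finset (Fin d → ZMod M) → ((Fin d → ZMod M) → ℝ) → ℂ) Finset.univ φ
            ∂(stepMeasure (𝒞 ((1 : Matrix (Fin d) (Fin d) ℝ) + hamTuningMap ρ h₀) (N + 1)))))
    -- four tuned seeds with their trajectories
    (x₀ : Bool → Bool → HamSpace ℂ d (fieldWt h (L : ℝ) d 0) ((L : ℝ) ^ 0) (L ^ (d * 0)))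
    (x : Bool → Bool → ∀ k, HamSpace ℂ d (fieldWt h (L : ℝ) d k) ((L : ℝ) ^ k) (L ^ (d * k)))
    (htr : ∀ i j, RGFlow.IsTunedQ (E := (fun k => HamSpace ℂ d (fieldWt h (L : ℝ) d k) ((L : ℝ) ^ k) (L ^ (d * k)))) (F := (fun k => activitySpace (abkmNormParams L N Mord R pT r₀ h θbar A (schedDelta δ₀ δ₁ N) fun j => 𝒞 1 j) k)) N
      (Asys (x₀ i j)) (Bsys (x₀ i j)) (Ssys (x₀ i j))
      (initAct (N := N) (Mord := Mord) (R := R) (p := pT) (r₀ := r₀) (θbar := θbar) (A := A) (δ₀ := δ₀)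
            (δ₁ := δ₁) (𝒞 := fun j => 𝒞 1 j) (Kf i j) (x₀ i j)) (x i j))
    (htu : ∀ i j, RGFlow.InTubeQ (E := (fun k => HamSpace ℂ d (fieldWt h (L : ℝ) d k) ((L : ℝ) ^ k) (L ^ (d * k)))) (F := (fun k => activitySpace (abkmNormParams L N Mord R pT r₀ h θbar A (schedDelta δ₀ δ₁ N) fun j => 𝒞 1 j) k)) N η ε (activityNormLE (abkmNormParams L N Mord R pT r₀ h θbar A (schedDelta δ₀ δ₁ N) fun j => 𝒞 1 j))
      (Ssys (x₀ i j))
      (initAct (N := N) (Mord := Mord) (R := R) (p := pT) (r₀ := r₀) (θbar := θbar) (A := A) (δ₀ := δ₀)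
            (δ₁ := δ₁) (𝒞 := fun j => 𝒞 1 j) (Kf i j) (x₀ i j)) (x i j))
    (hx : ∀ i j, x i j 0 = x₀ i j)
    -- the six sizes
    {T₁ T₂ T₁₂ B₁ B₂ B₁₂ : ℝ} (hT₁0 : 0 ≤ T₁) (hB₁0 : 0 ≤ B₁)
    (hd₁ : ∀ j, ‖x₀ true j - x₀ false j‖ ≤ T₁) (hd₂ : ∀ i, ‖x₀ i true - x₀ i false‖ ≤ T₂)
    (hd₁₂ : ‖x₀ true true - x₀ true false - x₀ false true + x₀ false false‖ ≤ T₁₂)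
    (hD₁ : ∀ j, ‖Φ (x₀ true j) (RGFlow.fwd (Ssys (x₀ true j)) (initAct (N := N) (Mord := Mord) (R := R) (p := pT) (r₀ := r₀) (θbar := θbar) (A := A) (δ₀ := δ₀)
            (δ₁ := δ₁) (𝒞 := fun j => 𝒞 1 j) (Kf true j) (x₀ true j)) (x true j) N)
        - Φ (x₀ false j) (RGFlow.fwd (Ssys (x₀ false j)) (initAct (N := N) (Mord := Mord) (R := R) (p := pT) (r₀ := r₀) (θbar := θbar) (A := A) (δ₀ := δ₀)
            (δ₁ := δ₁) (𝒞 := fun j => 𝒞 1 j) (Kf false j) (x₀ false j)) (x false j) N)‖ ≤ B₁)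
    (hD₂ : ∀ i, ‖Φ (x₀ i true) (RGFlow.fwd (Ssys (x₀ i true)) (initAct (N := N) (Mord := Mord) (R := R) (p := pT) (r₀ := r₀) (θbar := θbar) (A := A) (δ₀ := δ₀)
            (δ₁ := δ₁) (𝒞 := fun j => 𝒞 1 j) (Kf i true) (x₀ i true)) (x i true) N)
        - Φ (x₀ i false) (RGFlow.fwd (Ssys (x₀ i false)) (initAct (N := N) (Mord := Mord) (R := R) (p := pT) (r₀ := r₀) (θbar := θbar) (A := A) (δ₀ := δ₀)
            (δ₁ := δ₁) (𝒞 := fun j => 𝒞 1 j) (Kf i false) (x₀ i false)) (x i false) N)‖ ≤ B₂)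
    (hD₁₂ : ‖Φ (x₀ true true) (RGFlow.fwd (Ssys (x₀ true true)) (initAct (N := N) (Mord := Mord) (R := R) (p := pT) (r₀ := r₀) (θbar := θbar) (A := A) (δ₀ := δ₀)
            (δ₁ := δ₁) (𝒞 := fun j => 𝒞 1 j) (Kf true true) (x₀ true true)) (x true true) N)
        - Φ (x₀ true false) (RGFlow.fwd (Ssys (x₀ true false)) (initAct (N := N) (Mord := Mord) (R := R) (p := pT) (r₀ := r₀) (θbar := θbar) (A := A) (δ₀ := δ₀)
            (δ₁ := δ₁) (𝒞 := fun j => 𝒞 1 j) (Kf true false) (x₀ true false)) (x true false) N)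
        - Φ (x₀ false true) (RGFlow.fwd (Ssys (x₀ false true)) (initAct (N := N) (Mord := Mord) (R := R) (p := pT) (r₀ := r₀) (θbar := θbar) (A := A) (δ₀ := δ₀)
            (δ₁ := δ₁) (𝒞 := fun j => 𝒞 1 j) (Kf false true) (x₀ false true)) (x false true) N)
        + Φ (x₀ false false) (RGFlow.fwd (Ssys (x₀ false false)) (initAct (N := N) (Mord := Mord) (R := R) (p := pT) (r₀ := r₀) (θbar := θbar) (A := A) (δ₀ := δ₀)
            (δ₁ := δ₁) (𝒞 := fun j => 𝒞 1 j) (Kf false false) (x₀ false false)) (x false false) N)‖ ≤ B₁₂) :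
    ‖(((((Real.log (formChangeConst (M := M) (1 : Matrix (Fin d) (Fin d) ℝ)
              (1 + hamQuadForm (HamSpace.toHam (x₀ true true))))) : ℝ) : ℂ)
          + (Fintype.card (Fin d → ZMod M) : ℂ) * (HamSpace.toHam (x₀ true true)) (Sum.inl ())
          + Complex.log (∫ φ, pcirc 1 (fun V => expNegH (HamSpace.toHam (x₀ true true)) V φ)
            (fun U => initKH (Kf true true) (HamSpace.toHam (x₀ true true)) U φ) Finset.univ
          ∂(tailMeasure (fun jj => 𝒞 ((1 : Matrix (Fin d) (Fin d) ℝ) + hamQuadForm (HamSpace.toHam (x₀ true true))) jj) N N))))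
      - (((((Real.log (formChangeConst (M := M) (1 : Matrix (Fin d) (Fin d) ℝ)
              (1 + hamQuadForm (HamSpace.toHam (x₀ true false))))) : ℝ) : ℂ)
          + (Fintype.card (Fin d → ZMod M) : ℂ) * (HamSpace.toHam (x₀ true false)) (Sum.inl ())
          + Complex.log (∫ φ, pcirc 1 (fun V => expNegH (HamSpace.toHam (x₀ true false)) V φ)
            (fun U => initKH (Kf true false) (HamSpace.toHam (x₀ true false)) U φ) Finset.univ
          ∂(tailMeasure (fun jj => 𝒞 ((1 : Matrix (Fin d) (Fin d) ℝ) + hamQuadForm (HamSpace.toHam (x₀ true false))) jj) N N))))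
      - (((((Real.log (formChangeConst (M := M) (1 : Matrix (Fin d) (Fin d) ℝ)
              (1 + hamQuadForm (HamSpace.toHam (x₀ false true))))) : ℝ) : ℂ)
          + (Fintype.card (Fin d → ZMod M) : ℂ) * (HamSpace.toHam (x₀ false true)) (Sum.inl ())
          + Complex.log (∫ φ, pcirc 1 (fun V => expNegH (HamSpace.toHam (x₀ false true)) V φ)
            (fun U => initKH (Kf false true) (HamSpace.toHam (x₀ false true)) U φ) Finset.univ
          ∂(tailMeasure (fun jj => 𝒞 ((1 : Matrix (Fin d) (Fin d) ℝ) + hamQuadForm (HamSpace.toHam (x₀ false true))) jj) N N))))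
      + (((((Real.log (formChangeConst (M := M) (1 : Matrix (Fin d) (Fin d) ℝ)
              (1 + hamQuadForm (HamSpace.toHam (x₀ false false))))) : ℝ) : ℂ)
          + (Fintype.card (Fin d → ZMod M) : ℂ) * (HamSpace.toHam (x₀ false false)) (Sum.inl ())
          + Complex.log (∫ φ, pcirc 1 (fun V => expNegH (HamSpace.toHam (x₀ false false)) V φ)
            (fun U => initKH (Kf false false) (HamSpace.toHam (x₀ false false)) U φ) Finset.univ
          ∂(tailMeasure (fun jj => 𝒞 ((1 : Matrix (Fin d) (Fin d) ℝ) + hamQuadForm (HamSpace.toHam (x₀ false false))) jj) N N))))‖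
    ≤ (Fintype.card (Fin d → ZMod M) : ℝ) * (2 * (d : ℝ) ^ 2 / (((L ^ (d * 0) : ℕ) : ℝ) * (fieldWt h (L : ℝ) d 0 / (L : ℝ) ^ 0) ^ 2)) * T₁₂
      + 2 * (Fintype.card (Fin d → ZMod M) : ℝ) * (2 * (d : ℝ) ^ 2 / (((L ^ (d * 0) : ℕ) : ℝ) * (fieldWt h (L : ℝ) d 0 / (L : ℝ) ^ 0) ^ 2)) ^ 2 * T₁ * T₂
      + (Fintype.card (Fin d → ZMod M) : ℝ) * T₁₂
      + 1 / (1 - (3 * (ε * η ^ N * A⁻¹ * A𝒫'))) * B₁₂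
      + 1 / (1 - (3 * (ε * η ^ N * A⁻¹ * A𝒫'))) ^ 2 * B₁ * B₂ := by
  subst hAsys hBsys hSsys hΦ
  have hh : 0 < h := Fact.out
  have hd2 : 2 ≤ d := by omega
  have hA : 0 < A := by linarith
  have hA𝒫0 : 0 ≤ A𝒫' := by
    rw [← hA𝒫']
    exact zero_le_one.trans (one_le_weightIntConstRho hθbar hθ0 hθ
      (traceConst_nonneg d Mord R hlam.le (derivSum_nonneg d n _)))
  -- the four perturbations
  have hKfd : ∀ i j, ContDiff ℝ r₀ (Kf i j) := by
    intro i j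
    cases i <;> cases j
    · rw [hKff]; exact h𝒦
    · rw [hKft]; exact h𝒦.add hV
    · rw [hKtf]; exact h𝒦.add hU
    · rw [hKtt]; exact (h𝒦.add hU).add hV
  have hKfb : ∀ i j, ∀ s, s ≤ r₀ → ∀ z : Fin d → ℝ,
      ‖iteratedFDeriv ℝ s (Kf i j) z‖ ≤ ρ𝒦 * Real.exp ((∑ i, z i ^ 2) / 4) := by
    intro i j
    cases i <;> cases j
    · rw [hKff]; exact h𝒦b
    · rw [hKft]; exact h𝒦Vb
    · rw [hKtf]; exact h𝒦Ub
    · rw [hKtt]; exact h𝒦UVb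
  -- the seeds lie in the `ε`-ball
  have hxε : ∀ i j, ‖x₀ i j‖ ≤ ε := fun i j => by
    have h0 := (htu i j 0 (Nat.zero_le _)).1
    rw [pow_zero, mul_one, hx i j] at h0
    exact h0
  -- the last-scale integrals: identity and bound
  have hI : ∀ i j, (∫ φ, pcirc 1 (fun V => expNegH (HamSpace.toHam (x₀ i j)) V φ)
            (fun U => initKH (Kf i j) (HamSpace.toHam (x₀ i j)) U φ) Finset.univ
          ∂(tailMeasure (fun jj => 𝒞 ((1 : Matrix (Fin d) (Fin d) ℝ) + hamQuadForm (HamSpace.toHam (x₀ i j))) jj) N N))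
        = 1 + (∫ φ, ((RGFlow.fwd (rgSQ (L := L) (N := N) (Mord := Mord) (R := R) (p := pT) (r₀ := r₀) (h := h) (θbar := θbar) (A := A)
            (δ₀ := δ₀) (δ₁ := δ₁) (𝒞 := fun j => 𝒞 1 j) (fun jj => 𝒞 ((1 : Matrix (Fin d) (Fin d) ℝ) + hamTuningMap ρ (x₀ i j)) jj)) (initAct (N := N) (Mord := Mord) (R := R) (p := pT) (r₀ := r₀) (θbar := θbar) (A := A) (δ₀ := δ₀)
            (δ₁ := δ₁) (𝒞 := fun j => 𝒞 1 j) (Kf i j) (x₀ i j)) (x i j) N : activitySpace (abkmNormParams L N Mord R pT r₀ h θbar A (schedDelta δ₀ δ₁ N) fun j => 𝒞 1 j) N) : Finset (Fin d → ZMod M) → ((Fin d → ZMod M) → ℝ) → ℂ) Finset.univ φ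
            ∂(stepMeasure (𝒞 ((1 : Matrix (Fin d) (Fin d) ℝ) + hamTuningMap ρ (x₀ i j)) (N + 1)))) ∧
      ‖(∫ φ, pcirc 1 (fun V => expNegH (HamSpace.toHam (x₀ i j)) V φ)
            (fun U => initKH (Kf i j) (HamSpace.toHam (x₀ i j)) U φ) Finset.univ
          ∂(tailMeasure (fun jj => 𝒞 ((1 : Matrix (Fin d) (Fin d) ℝ) + hamQuadForm (HamSpace.toHam (x₀ i j))) jj) N N)) - 1‖ ≤ ε * η ^ N * A⁻¹ * A𝒫' :=
    fun i j => integral_flowStart_eq_one_add_lastScaleInt hd hMord hMR hLodd hL hR2 hM hθbar hlam hn hn2 hnñ hc hC1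
      hallA hB hp hpM hr₀ hδ₀ hδ₁ hh0 hh2 hθ0 hθ hT₀ hKT₀ hA𝒫' hA1 hA𝒫A hsmall hr hv hωA hc3A hc2A hη hη1 hε hεr hερ
      hρ16 (hKfd i j) (hKfb i j) h𝒦small hp4 hqT₀ ((hxε i j).trans hερ) (htr i j) (htu i j) (hx i j)
  -- the radius `R₀ = 3εη^N A⁻¹A_𝒫 < 1`
  have h0AA : 0 ≤ A⁻¹ * A𝒫' := mul_nonneg (inv_pos.2 hA).le hA𝒫0
  have hx1 : ε * η ^ N * A⁻¹ * A𝒫' ≤ ε := by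
    have hηN : η ^ N ≤ 1 := pow_le_one₀ hη.le hη1
    have hAA : A⁻¹ * A𝒫' ≤ 1 := by rw [inv_mul_le_iff₀ hA]; linarith
    calc ε * η ^ N * A⁻¹ * A𝒫' = ε * (η ^ N * (A⁻¹ * A𝒫')) := by ring
      _ ≤ ε * (1 * 1) := by gcongr
      _ = ε := by ring
  have hx0 : 0 ≤ ε * η ^ N * A⁻¹ * A𝒫' := by
    have := pow_nonneg hη.le N
    calc (0 : ℝ) = ε * η ^ N * 0 := by ring
      _ ≤ ε * η ^ N * (A⁻¹ * A𝒫') := by gcongr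
      _ = ε * η ^ N * A⁻¹ * A𝒫' := by ring
  have hR₀ : (3 * (ε * η ^ N * A⁻¹ * A𝒫')) < 1 := by linarith
  have hI3 : ∀ i j, ‖(∫ φ, pcirc 1 (fun V => expNegH (HamSpace.toHam (x₀ i j)) V φ)
            (fun U => initKH (Kf i j) (HamSpace.toHam (x₀ i j)) U φ) Finset.univ
          ∂(tailMeasure (fun jj => 𝒞 ((1 : Matrix (Fin d) (Fin d) ℝ) + hamQuadForm (HamSpace.toHam (x₀ i j))) jj) N N)) - 1‖ ≤ (3 * (ε * η ^ N * A⁻¹ * A𝒫')) / 3 := fun i j => by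
    have := (hI i j).2; linarith
  have hI1 : ‖(∫ φ, pcirc 1 (fun V => expNegH (HamSpace.toHam (x₀ true true)) V φ)
            (fun U => initKH (Kf true true) (HamSpace.toHam (x₀ true true)) U φ) Finset.univ
          ∂(tailMeasure (fun jj => 𝒞 ((1 : Matrix (Fin d) (Fin d) ℝ) + hamQuadForm (HamSpace.toHam (x₀ true true))) jj) N N)) - 1‖ ≤ (3 * (ε * η ^ N * A⁻¹ * A𝒫')) := by
    have := hI3 true true; linarith
  -- the seeds are small for the form-change calculus
  have hcq0 : 0 ≤ (2 * (d : ℝ) ^ 2 / (((L ^ (d * 0) : ℕ) : ℝ) * (fieldWt h (L : ℝ) d 0 / (L : ℝ) ^ 0) ^ 2)) := by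
    have : 0 < fieldWt h (L : ℝ) d 0 := Fact.out
    positivity
  have hh6 : ∀ i j, (2 * (d : ℝ) ^ 2 / (((L ^ (d * 0) : ℕ) : ℝ) * (fieldWt h (L : ℝ) d 0 / (L : ℝ) ^ 0) ^ 2)) * ‖x₀ i j‖ ≤ 1 / 6 := fun i j =>
    (mul_le_mul_of_nonneg_left (hxε i j) hcq0).trans hqε
  have hh2' : (2 * (d : ℝ) ^ 2 / (((L ^ (d * 0) : ℕ) : ℝ) * (fieldWt h (L : ℝ) d 0 / (L : ℝ) ^ 0) ^ 2)) * ‖x₀ true true‖ ≤ 1 / 2 := (hh6 true true).trans (by norm_num)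
  -- the algebra of the three pieces
  have hP := norm_secondDiff_freeEnergyPiece_le (M := M) hR₀ (x₀ false false) (x₀ true false) (x₀ false true) (x₀ true true)
    (∫ φ, pcirc 1 (fun V => expNegH (HamSpace.toHam (x₀ false false)) V φ)
            (fun U => initKH (Kf false false) (HamSpace.toHam (x₀ false false)) U φ) Finset.univ
          ∂(tailMeasure (fun jj => 𝒞 ((1 : Matrix (Fin d) (Fin d) ℝ) + hamQuadForm (HamSpace.toHam (x₀ false false))) jj) N N))
    (∫ φ, pcirc 1 (fun V => expNegH (HamSpace.toHam (x₀ true false)) V φ)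
            (fun U => initKH (Kf true false) (HamSpace.toHam (x₀ true false)) U φ) Finset.univ
          ∂(tailMeasure (fun jj => 𝒞 ((1 : Matrix (Fin d) (Fin d) ℝ) + hamQuadForm (HamSpace.toHam (x₀ true false))) jj) N N))
    (∫ φ, pcirc 1 (fun V => expNegH (HamSpace.toHam (x₀ false true)) V φ)
            (fun U => initKH (Kf false true) (HamSpace.toHam (x₀ false true)) U φ) Finset.univ
          ∂(tailMeasure (fun jj => 𝒞 ((1 : Matrix (Fin d) (Fin d) ℝ) + hamQuadForm (HamSpace.toHam (x₀ false true))) jj) N N))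
    (∫ φ, pcirc 1 (fun V => expNegH (HamSpace.toHam (x₀ true true)) V φ)
            (fun U => initKH (Kf true true) (HamSpace.toHam (x₀ true true)) U φ) Finset.univ
          ∂(tailMeasure (fun jj => 𝒞 ((1 : Matrix (Fin d) (Fin d) ℝ) + hamQuadForm (HamSpace.toHam (x₀ true true))) jj) N N))
    (hh6 false false) (hh6 true false) (hh6 false true) hh2' (hI3 false false) (hI3 true false) (hI3 false true) hI1
  -- the `I`-differences are `Φ`-differences
  have eI : ∀ i j, (∫ φ, pcirc 1 (fun V => expNegH (HamSpace.toHam (x₀ i j)) V φ)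
            (fun U => initKH (Kf i j) (HamSpace.toHam (x₀ i j)) U φ) Finset.univ
          ∂(tailMeasure (fun jj => 𝒞 ((1 : Matrix (Fin d) (Fin d) ℝ) + hamQuadForm (HamSpace.toHam (x₀ i j))) jj) N N))
      = 1 + (∫ φ, ((RGFlow.fwd (rgSQ (L := L) (N := N) (Mord := Mord) (R := R) (p := pT) (r₀ := r₀) (h := h) (θbar := θbar) (A := A)
            (δ₀ := δ₀) (δ₁ := δ₁) (𝒞 := fun j => 𝒞 1 j) (fun jj => 𝒞 ((1 : Matrix (Fin d) (Fin d) ℝ) + hamTuningMap ρ (x₀ i j)) jj)) (initAct (N := N) (Mord := Mord) (R := R) (p := pT) (r₀ := r₀) (θbar := θbar) (A := A) (δ₀ := δ₀)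
            (δ₁ := δ₁) (𝒞 := fun j => 𝒞 1 j) (Kf i j) (x₀ i j)) (x i j) N : activitySpace (abkmNormParams L N Mord R pT r₀ h θbar A (schedDelta δ₀ δ₁ N) fun j => 𝒞 1 j) N) : Finset (Fin d → ZMod M) → ((Fin d → ZMod M) → ℝ) → ℂ) Finset.univ φ
            ∂(stepMeasure (𝒞 ((1 : Matrix (Fin d) (Fin d) ℝ) + hamTuningMap ρ (x₀ i j)) (N + 1)))) :=
    fun i j => (hI i j).1
  have hB1 : ‖(∫ φ, pcirc 1 (fun V => expNegH (HamSpace.toHam (x₀ true false)) V φ)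
            (fun U => initKH (Kf true false) (HamSpace.toHam (x₀ true false)) U φ) Finset.univ
          ∂(tailMeasure (fun jj => 𝒞 ((1 : Matrix (Fin d) (Fin d) ℝ) + hamQuadForm (HamSpace.toHam (x₀ true false))) jj) N N)) - (∫ φ, pcirc 1 (fun V => expNegH (HamSpace.toHam (x₀ false false)) V φ)
            (fun U => initKH (Kf false false) (HamSpace.toHam (x₀ false false)) U φ) Finset.univ
          ∂(tailMeasure (fun jj => 𝒞 ((1 : Matrix (Fin d) (Fin d) ℝ) + hamQuadForm (HamSpace.toHam (x₀ false false))) jj) N N))‖ ≤ B₁ := by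
    rw [eI true false, eI false false, add_sub_add_left_eq_sub]; exact hD₁ false
  have hB2 : ‖(∫ φ, pcirc 1 (fun V => expNegH (HamSpace.toHam (x₀ false true)) V φ)
            (fun U => initKH (Kf false true) (HamSpace.toHam (x₀ false true)) U φ) Finset.univ
          ∂(tailMeasure (fun jj => 𝒞 ((1 : Matrix (Fin d) (Fin d) ℝ) + hamQuadForm (HamSpace.toHam (x₀ false true))) jj) N N)) - (∫ φ, pcirc 1 (fun V => expNegH (HamSpace.toHam (x₀ false false)) V φ)
            (fun U => initKH (Kf false false) (HamSpace.toHam (x₀ false false)) U φ) Finset.univ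
          ∂(tailMeasure (fun jj => 𝒞 ((1 : Matrix (Fin d) (Fin d) ℝ) + hamQuadForm (HamSpace.toHam (x₀ false false))) jj) N N))‖ ≤ B₂ := by
    rw [eI false true, eI false false, add_sub_add_left_eq_sub]; exact hD₂ false
  have hB12 : ‖(∫ φ, pcirc 1 (fun V => expNegH (HamSpace.toHam (x₀ true true)) V φ)
            (fun U => initKH (Kf true true) (HamSpace.toHam (x₀ true true)) U φ) Finset.univ
          ∂(tailMeasure (fun jj => 𝒞 ((1 : Matrix (Fin d) (Fin d) ℝ) + hamQuadForm (HamSpace.toHam (x₀ true true))) jj) N N)) - (∫ φ, pcirc 1 (fun V => expNegH (HamSpace.toHam (x₀ true false)) V φ)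
            (fun U => initKH (Kf true false) (HamSpace.toHam (x₀ true false)) U φ) Finset.univ
          ∂(tailMeasure (fun jj => 𝒞 ((1 : Matrix (Fin d) (Fin d) ℝ) + hamQuadForm (HamSpace.toHam (x₀ true false))) jj) N N)) - (∫ φ, pcirc 1 (fun V => expNegH (HamSpace.toHam (x₀ false true)) V φ)
            (fun U => initKH (Kf false true) (HamSpace.toHam (x₀ false true)) U φ) Finset.univ
          ∂(tailMeasure (fun jj => 𝒞 ((1 : Matrix (Fin d) (Fin d) ℝ) + hamQuadForm (HamSpace.toHam (x₀ false true))) jj) N N)) + (∫ φ, pcirc 1 (fun V => expNegH (HamSpace.toHam (x₀ false false)) V φ)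
            (fun U => initKH (Kf false false) (HamSpace.toHam (x₀ false false)) U φ) Finset.univ
          ∂(tailMeasure (fun jj => 𝒞 ((1 : Matrix (Fin d) (Fin d) ℝ) + hamQuadForm (HamSpace.toHam (x₀ false false))) jj) N N))‖ ≤ B₁₂ := by
    rw [eI true true, eI true false, eI false true, eI false false]
    have e : ∀ a b c e : ℂ, (1 + a) - (1 + b) - (1 + c) + (1 + e) = a - b - c + e := fun a b c e => by ring
    rw [e]
    exact hD₁₂
  -- monotonicity of the five terms
  have hV0 : 0 ≤ (Fintype.card (Fin d → ZMod M) : ℝ) := by positivity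
  have hK0 : 0 < 1 - (3 * (ε * η ^ N * A⁻¹ * A𝒫')) := by linarith
  have t1 : (Fintype.card (Fin d → ZMod M) : ℝ) * (2 * (d : ℝ) ^ 2 / (((L ^ (d * 0) : ℕ) : ℝ) * (fieldWt h (L : ℝ) d 0 / (L : ℝ) ^ 0) ^ 2)) * ‖x₀ true true - x₀ true false - x₀ false true + x₀ false false‖ ≤ (Fintype.card (Fin d → ZMod M) : ℝ) * (2 * (d : ℝ) ^ 2 / (((L ^ (d * 0) : ℕ) : ℝ) * (fieldWt h (L : ℝ) d 0 / (L : ℝ) ^ 0) ^ 2)) * T₁₂ :=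
    mul_le_mul_of_nonneg_left hd₁₂ (mul_nonneg hV0 hcq0)
  have t2 : 2 * (Fintype.card (Fin d → ZMod M) : ℝ) * (2 * (d : ℝ) ^ 2 / (((L ^ (d * 0) : ℕ) : ℝ) * (fieldWt h (L : ℝ) d 0 / (L : ℝ) ^ 0) ^ 2)) ^ 2 * ‖x₀ true false - x₀ false false‖ * ‖x₀ false true - x₀ false false‖
      ≤ 2 * (Fintype.card (Fin d → ZMod M) : ℝ) * (2 * (d : ℝ) ^ 2 / (((L ^ (d * 0) : ℕ) : ℝ) * (fieldWt h (L : ℝ) d 0 / (L : ℝ) ^ 0) ^ 2)) ^ 2 * T₁ * T₂ :=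
    mul_le_mul (mul_le_mul_of_nonneg_left (hd₁ false) (by positivity)) (hd₂ false) (norm_nonneg _) (by positivity)
  have t3 : (Fintype.card (Fin d → ZMod M) : ℝ) * ‖x₀ true true - x₀ true false - x₀ false true + x₀ false false‖ ≤ (Fintype.card (Fin d → ZMod M) : ℝ) * T₁₂ :=
    mul_le_mul_of_nonneg_left hd₁₂ hV0
  have t4 : 1 / (1 - (3 * (ε * η ^ N * A⁻¹ * A𝒫'))) * ‖(∫ φ, pcirc 1 (fun V => expNegH (HamSpace.toHam (x₀ true true)) V φ)
            (fun U => initKH (Kf true true) (HamSpace.toHam (x₀ true true)) U φ) Finset.univ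
          ∂(tailMeasure (fun jj => 𝒞 ((1 : Matrix (Fin d) (Fin d) ℝ) + hamQuadForm (HamSpace.toHam (x₀ true true))) jj) N N)) - (∫ φ, pcirc 1 (fun V => expNegH (HamSpace.toHam (x₀ true false)) V φ)
            (fun U => initKH (Kf true false) (HamSpace.toHam (x₀ true false)) U φ) Finset.univ
          ∂(tailMeasure (fun jj => 𝒞 ((1 : Matrix (Fin d) (Fin d) ℝ) + hamQuadForm (HamSpace.toHam (x₀ true false))) jj) N N)) - (∫ φ, pcirc 1 (fun V => expNegH (HamSpace.toHam (x₀ false true)) V φ)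
            (fun U => initKH (Kf false true) (HamSpace.toHam (x₀ false true)) U φ) Finset.univ
          ∂(tailMeasure (fun jj => 𝒞 ((1 : Matrix (Fin d) (Fin d) ℝ) + hamQuadForm (HamSpace.toHam (x₀ false true))) jj) N N)) + (∫ φ, pcirc 1 (fun V => expNegH (HamSpace.toHam (x₀ false false)) V φ)
            (fun U => initKH (Kf false false) (HamSpace.toHam (x₀ false false)) U φ) Finset.univ
          ∂(tailMeasure (fun jj => 𝒞 ((1 : Matrix (Fin d) (Fin d) ℝ) + hamQuadForm (HamSpace.toHam (x₀ false false))) jj) N N))‖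
      ≤ 1 / (1 - (3 * (ε * η ^ N * A⁻¹ * A𝒫'))) * B₁₂ :=
    mul_le_mul_of_nonneg_left hB12 (div_pos one_pos hK0).le
  have t5 : 1 / (1 - (3 * (ε * η ^ N * A⁻¹ * A𝒫'))) ^ 2 * ‖(∫ φ, pcirc 1 (fun V => expNegH (HamSpace.toHam (x₀ true false)) V φ)
            (fun U => initKH (Kf true false) (HamSpace.toHam (x₀ true false)) U φ) Finset.univ
          ∂(tailMeasure (fun jj => 𝒞 ((1 : Matrix (Fin d) (Fin d) ℝ) + hamQuadForm (HamSpace.toHam (x₀ true false))) jj) N N)) - (∫ φ, pcirc 1 (fun V => expNegH (HamSpace.toHam (x₀ false false)) V φ)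
            (fun U => initKH (Kf false false) (HamSpace.toHam (x₀ false false)) U φ) Finset.univ
          ∂(tailMeasure (fun jj => 𝒞 ((1 : Matrix (Fin d) (Fin d) ℝ) + hamQuadForm (HamSpace.toHam (x₀ false false))) jj) N N))‖ * ‖(∫ φ, pcirc 1 (fun V => expNegH (HamSpace.toHam (x₀ false true)) V φ)
            (fun U => initKH (Kf false true) (HamSpace.toHam (x₀ false true)) U φ) Finset.univ
          ∂(tailMeasure (fun jj => 𝒞 ((1 : Matrix (Fin d) (Fin d) ℝ) + hamQuadForm (HamSpace.toHam (x₀ false true))) jj) N N)) - (∫ φ, pcirc 1 (fun V => expNegH (HamSpace.toHam (x₀ false false)) V φ)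
            (fun U => initKH (Kf false false) (HamSpace.toHam (x₀ false false)) U φ) Finset.univ
          ∂(tailMeasure (fun jj => 𝒞 ((1 : Matrix (Fin d) (Fin d) ℝ) + hamQuadForm (HamSpace.toHam (x₀ false false))) jj) N N))‖
      ≤ 1 / (1 - (3 * (ε * η ^ N * A⁻¹ * A𝒫'))) ^ 2 * B₁ * B₂ :=
    mul_le_mul (mul_le_mul_of_nonneg_left hB1 (by positivity)) hB2 (norm_nonneg _) (mul_nonneg (by positivity) hB₁0)
  exact hP.trans (by linarith [t1, t2, t3, t4, t5])

end Package

end Summit.HubbardSuperconductivity.HubbardSuperconductivity.Theorems.ComplexGFF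

end
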